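import Mathlib
import Summits.ValiantsHypothesis.ValiantsHypothesis.Theses.ValuativeGCT
import Summits.ValiantsHypothesis.ValiantsHypothesis.Theses.GCTMult
import Summits.ValiantsHypothesis.ValiantsHypothesis.Theorems.ValuativeGCTValuativeBound
import Summits.ValiantsHypothesis.ValiantsHypothesis.Theorems.ValuativeGCTNoValuativeFlipReductions
import Summits.ValiantsHypothesis.ValiantsHypothesis.Theorems.ValuativeGCTNoValuativeFlipResidual
import Summits.ValiantsHypothesis.ValiantsHypothesis.Theorems.ValuativeGCTValuativeFlipBottomWindow
import Summits.ValiantsHypothesis.ValiantsHypothesis.Theorems.ValuativeGCTGctMultPrinciple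
import Literature.Computability.AlgebraicComplexity.OrbitClosureProofs

/-!
# `NoValuativeFlip` (stmt-ValiantsHypothesis-12629): unconditional position and the padding exponent

Route `ValuativeGCT`, support item `NoValuativeFlip` (the valuative no-go: from some polynomial
padding `m ≥ n ^ c₀` on, for every singular-space truncation `(U, r)` and every `(δ, λ)`,
`mult_λ* ℂ[Δ(X₀₀^(m-n) per_n)] ≤ dim T_U(λ)`).

With the crux `ValuativeBound` now a theorem (`ValuativeBound.ValuativeBound_proof`,
`Theorems/ValuativeGCTValuativeBound.lean`), every fragment of the item that the first prover seat
proved conditionally on it becomes unconditional; this file records the resulting position of the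
item, sorry-free:

* §1 `noValuativeFlip_of_gctNoMultBarrier'` — `GCTMult.GctNoMultBarrier → NoValuativeFlip` (the only
  remaining hypothesis is the open multiplicity no-go, stmt-ValiantsHypothesis-0890);
  `dcPerSuperpolynomial_of_not_noValuativeFlip'` — `¬ NoValuativeFlip → DcPerSuperpolynomial ℂ`
  (refuting the item proves Valiant's hypothesis in determinantal-complexity form); hence the
  dichotomy `noValuativeFlip_or_dcPerSuperpolynomial`.
* §2 the unconditional no-flip ranges (beyond Grenet `2ⁿ ≤ m + 1`; bounded length
  `m ≥ 1 + n (n+1)^ℓ(λ)`; outside the Kadish–Landsberg cone was unconditional already) and the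
  unconditional residual equivalence `noValuativeFlip_iff_residual'`: the item IS the multiplicity
  no-go on Kadish–Landsberg shapes of growing length at paddings `n ^ c₀ ≤ m < 2ⁿ - 1`.
* §3 NEW: the padding exponent is load-bearing — `two_le_of_noValuativeFlip_exponent`: any witness
  `(c₀, n₀)` of `NoValuativeFlip` has `c₀ ≥ 2`, because at `m = n ≥ 3` the no-cut truncation
  `T_⊥(λ)` is beaten by the permanent's orbit closure for some `λ` (the bottom-of-the-window flip
  `ValuativeFlip.valuativeFlip_cruxBody_bottom`, a Hilbert-function count); equivalently the
  linear-padding version of the item is FALSE (`not_noValuativeFlip_linearPadding`), and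
  `noValuativeFlip_iff_two_le` normalises the item to exponents `c₀ ≥ 2`.
* §4 the same pin for the sister no-go `GCTMult.GctNoMultBarrier` (stmt-ValiantsHypothesis-0890):
  at `m = n ≥ 3` there is a genuine MULTIPLICITY obstruction `K_n(λ*) < mult_λ* ℂ[Δ_n(per_n)]`
  (`exists_orbitMultiplicity_det_lt_per`, = valuative bound ∘ bottom flip), so its exponents are
  `≥ 2` as well (`two_le_of_gctNoMultBarrier_exponent`, `gctNoMultBarrier_iff_two_le`).
* §5 consequence at the bottom of the window: `not_hasBorderDetRepr_self` — for `n ≥ 3`,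
  `per_n ∉ \overline{GL_{n²} · det_n}` (`¬ HasBorderDetRepr ℂ n n`), by the multiplicity-obstruction
  principle (`GctMultPrinciple_proof`, stmt-0889) applied to `exists_orbitMultiplicity_det_lt_per`
  — a formal multiplicity-obstruction proof of a border lower bound; hence
  `lt_borderDetComplexityPer_self : n < bdc(per_n)` (the tree had `n ≤ bdc(per_n)` only;
  in print `bdc(per_n) ≥ n²/2`, Landsberg–Manivel–Ressayre 2013, is a named fact).

Sources: BLMW 2011 (arXiv:0907.2850) §5; Bürgisser–Ikenmeyer–Panova 2019 (arXiv:1604.06431) §1;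
Bläser–Ikenmeyer 2025 (doi:10.4086/toc.gs.2025.010) §12.4; Mulmuley–Sohoni 2001 §4.
-/

-- `Summit.ValiantsHypothesis.ValiantsHypothesis.…` repeats a component by the D-0017 layout
-- (single-conjunct summit), which the `dupNamespace` linter flags; the name is mandated.
set_option linter.dupNamespace false

namespace Summit.ValiantsHypothesis.ValiantsHypothesis.Theorems.NoValuativeFlip

open Literature.NumberTheory.DiophantineGeometry Literature.Computability.AlgebraicComplexity
open Summit.ValiantsHypothesis.ValiantsHypothesis.Theses.ValuativeGCT
open Summit.ValiantsHypothesis.ValiantsHypothesis.Theorems.ValuativeBound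
open Summit.ValiantsHypothesis.ValiantsHypothesis.Theorems.ValuativeFlip

/-! ## §1 The logical position, unconditionally -/

/-- **`NoValuativeFlip` from the multiplicity no-go, unconditionally in the route**: the open
statement `GCTMult.GctNoMultBarrier` (stmt-ValiantsHypothesis-0890: `mult_pp ≤ K_m` beyond some
polynomial padding) implies `NoValuativeFlip`, since `K_m(λ*) ≤ dim T_U(λ)` is now the theorem
`ValuativeBound_proof`. -/
theorem noValuativeFlip_of_gctNoMultBarrier'
    (hB : Summit.ValiantsHypothesis.ValiantsHypothesis.Theses.GCTMult.GctNoMultBarrier) :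
    NoValuativeFlip :=
  noValuativeFlip_of_gctNoMultBarrier hB ValuativeBound_proof

/-- **Refuting `NoValuativeFlip` yields border obstructions beyond every polynomial padding**
(unconditional form of `exists_not_hasBorderDetRepr_of_not_noValuativeFlip`): if the item fails then
for every exponent `c` and threshold `n₀` there are `n ≥ n₀` and `m ≥ n ^ c`, `m ≥ n`, with
`X₀₀^(m-n) per_n ∉ Δ(det_m)`. -/
theorem exists_not_hasBorderDetRepr_of_not_noValuativeFlip' (hS : ¬ NoValuativeFlip) (c n₀ : ℕ) :
    ∃ n : ℕ, n₀ ≤ n ∧ ∃ (m : ℕ) (_ : NeZero m), n ≤ m ∧ n ^ c ≤ m ∧ ¬ HasBorderDetRepr ℂ n m :=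
  exists_not_hasBorderDetRepr_of_not_noValuativeFlip ValuativeBound_proof hS c n₀

/-- **Refuting `NoValuativeFlip` proves Valiant's hypothesis in determinantal-complexity form**
(unconditional form of `dcPerSuperpolynomial_of_not_noValuativeFlip`): `¬ NoValuativeFlip` implies
that `dc(per_n)` is not polynomially bounded over `ℂ` (`DcPerSuperpolynomial ℂ`, Landsberg 2017
Conj. 1.2.4.2 — open). So a refutation of the item is at least as hard as `VBP ≠ VNP` over `ℂ`. -/
theorem dcPerSuperpolynomial_of_not_noValuativeFlip' (hS : ¬ NoValuativeFlip) :
    DcPerSuperpolynomial ℂ :=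
  dcPerSuperpolynomial_of_not_noValuativeFlip ValuativeBound_proof hS

/-- **Dichotomy.** Either the valuative no-go `NoValuativeFlip` holds, or the determinantal
complexity of the permanent is superpolynomial over `ℂ`. (Classical case split on the item.) -/
theorem noValuativeFlip_or_dcPerSuperpolynomial : NoValuativeFlip ∨ DcPerSuperpolynomial ℂ := by
  by_cases h : NoValuativeFlip
  · exact Or.inl h
  · exact Or.inr (dcPerSuperpolynomial_of_not_noValuativeFlip' h)

/-! ## §2 The unconditional no-flip ranges and the residual statement -/

/-- **No valuative flip beyond Grenet's bound, unconditionally**: for `2ⁿ ≤ m + 1` the inequality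
of `NoValuativeFlip` holds for every centre `(U, r)`, every `δ` and every `λ ⊢ m δ` with at most
`m²` parts (`mult_pp(λ*) ≤ K_m(λ*) ≤ dim T_U(λ)`: Grenet's representation puts the padded permanent
inside `Δ(det_m)`, then `ValuativeBound_proof`). -/
theorem noValuativeFlip_body_of_two_pow_le' {n : ℕ} (m : ℕ) [NeZero m] (hm : 2 ^ n ≤ m + 1)
    (U : Submodule ℂ (Literature.NumberTheory.DiophantineGeometry.MatIdx m → ℂ)) (r : ℕ)
    (hU : ∀ u ∈ U, (Matrix.of fun a b : Fin m => u (toLex (a, b))).rank ≤ r)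
    (δ : ℕ) (lam : Nat.Partition (m * δ)) (hcard : lam.parts.card ≤ m * m) :
    let χ : Literature.NumberTheory.DiophantineGeometry.Weight (Literature.NumberTheory.DiophantineGeometry.MatIdx m) := (Literature.NumberTheory.DiophantineGeometry.Weight.dualOfPartition (m * m) lam).toMatIdx; let T : Submodule ℂ (MvPolynomial (Literature.NumberTheory.DiophantineGeometry.MatIdx m × Literature.NumberTheory.DiophantineGeometry.MatIdx m) ℂ) := MvPolynomial.homogeneousSubmodule (Literature.NumberTheory.DiophantineGeometry.MatIdx m × Literature.NumberTheory.DiophantineGeometry.MatIdx m) ℂ (m * δ) ⊓ ((MvPolynomial.vanishingIdeal ℂ {p : Literature.NumberTheory.DiophantineGeometry.MatIdx m × Literature.NumberTheory.DiophantineGeometry.MatIdx m → ℂ | ∀ j : Literature.NumberTheory.DiophantineGeometry.MatIdx m, (fun i => p (j, i)) ∈ U}) ^ (δ * (m - r))).restrictScalars ℂ ⊓ (⨅ (M : Matrix (Literature.NumberTheory.DiophantineGeometry.MatIdx m) (Literature.NumberTheory.DiophantineGeometry.MatIdx m) ℂ) (_ : Literature.Computability.AlgebraicComplexity.linSubst (Literature.NumberTheory.DiophantineGeometry.MatIdx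 m) ℂ M (Literature.NumberTheory.DiophantineGeometry.detFormLex ℂ m) = Literature.NumberTheory.DiophantineGeometry.detFormLex ℂ m), LinearMap.ker ((MvPolynomial.aeval (R := ℂ) fun p : Literature.NumberTheory.DiophantineGeometry.MatIdx m × Literature.NumberTheory.DiophantineGeometry.MatIdx m => ∑ l : Literature.NumberTheory.DiophantineGeometry.MatIdx m, M l p.2 • MvPolynomial.X (p.1, l)).toLinearMap - LinearMap.id (R := ℂ) (M := MvPolynomial (Literature.NumberTheory.DiophantineGeometry.MatIdx m × Literature.NumberTheory.DiophantineGeometry.MatIdx m) ℂ))) ⊓ (⨅ (g : Matrix.GeneralLinearGroup (Literature.NumberTheory.DiophantineGeometry.MatIdx m) ℂ) (_ : Literature.NumberTheory.DiophantineGeometry.IsUpperTriangular g), LinearMap.ker ((MvPolynomial.aeval (R := ℂ) fun p : Literature.NumberTheory.DiophantineGeometry.MatIdx m × Literature.NumberTheory.DiophantineGeometry.MatIdx m => ∑ l : Literature.NumberTheory.DiophantineGeometry.MatIdx m, ((g⁻¹ : Matrix.GeneralLinearGroup (Literature.NumberTheory.DiophantineGeometry.MatIdx m) ℂ) : Matrix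 (Literature.NumberTheory.DiophantineGeometry.MatIdx m) (Literature.NumberTheory.DiophantineGeometry.MatIdx m) ℂ) p.1 l • MvPolynomial.X (l, p.2)).toLinearMap - Literature.NumberTheory.DiophantineGeometry.weightChar χ g • LinearMap.id (R := ℂ) (M := MvPolynomial (Literature.NumberTheory.DiophantineGeometry.MatIdx m × Literature.NumberTheory.DiophantineGeometry.MatIdx m) ℂ))); Literature.NumberTheory.DiophantineGeometry.orbitMultiplicity ℂ (Literature.NumberTheory.DiophantineGeometry.paddedPerFormLex ℂ n m) m χ ≤ Module.finrank ℂ ↥T :=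
  noValuativeFlip_body_of_two_pow_le ValuativeBound_proof m hm U r hU δ lam hcard

/-- **No valuative flip on shapes of bounded length, unconditionally**: for
`m ≥ 1 + n (n + 1)^ℓ(λ)` the inequality of `NoValuativeFlip` holds at `λ` for every centre
(support transfer + sized Valiant universality give `mult_pp(λ*) ≤ K_m(λ*)`, then
`ValuativeBound_proof`). -/
theorem noValuativeFlip_body_of_card_parts' {n : ℕ} (m : ℕ) [NeZero m]
    (U : Submodule ℂ (Literature.NumberTheory.DiophantineGeometry.MatIdx m → ℂ)) (r : ℕ)
    (hU : ∀ u ∈ U, (Matrix.of fun a b : Fin m => u (toLex (a, b))).rank ≤ r)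
    (δ : ℕ) (lam : Nat.Partition (m * δ)) (hcard : lam.parts.card ≤ m * m)
    (hm : 1 + n * (n + 1) ^ lam.parts.card ≤ m) :
    let χ : Literature.NumberTheory.DiophantineGeometry.Weight (Literature.NumberTheory.DiophantineGeometry.MatIdx m) := (Literature.NumberTheory.DiophantineGeometry.Weight.dualOfPartition (m * m) lam).toMatIdx; let T : Submodule ℂ (MvPolynomial (Literature.NumberTheory.DiophantineGeometry.MatIdx m × Literature.NumberTheory.DiophantineGeometry.MatIdx m) ℂ) := MvPolynomial.homogeneousSubmodule (Literature.NumberTheory.DiophantineGeometry.MatIdx m × Literature.NumberTheory.DiophantineGeometry.MatIdx m) ℂ (m * δ) ⊓ ((MvPolynomial.vanishingIdeal ℂ {p : Literature.NumberTheory.DiophantineGeometry.MatIdx m × Literature.NumberTheory.DiophantineGeometry.MatIdx m → ℂ | ∀ j : Literature.NumberTheory.DiophantineGeometry.MatIdx m, (fun i => p (j, i)) ∈ U}) ^ (δ * (m - r))).restrictScalars ℂ ⊓ (⨅ (M : Matrix (Literature.NumberTheory.DiophantineGeometry.MatIdx m) (Literature.NumberTheory.DiophantineGeometry.MatIdx m)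 ℂ) (_ : Literature.Computability.AlgebraicComplexity.linSubst (Literature.NumberTheory.DiophantineGeometry.MatIdx m) ℂ M (Literature.NumberTheory.DiophantineGeometry.detFormLex ℂ m) = Literature.NumberTheory.DiophantineGeometry.detFormLex ℂ m), LinearMap.ker ((MvPolynomial.aeval (R := ℂ) fun p : Literature.NumberTheory.DiophantineGeometry.MatIdx m × Literature.NumberTheory.DiophantineGeometry.MatIdx m => ∑ l : Literature.NumberTheory.DiophantineGeometry.MatIdx m, M l p.2 • MvPolynomial.X (p.1, l)).toLinearMap - LinearMap.id (R := ℂ) (M := MvPolynomial (Literature.NumberTheory.DiophantineGeometry.MatIdx m × Literature.NumberTheory.DiophantineGeometry.MatIdx m) ℂ))) ⊓ (⨅ (g : Matrix.GeneralLinearGroup (Literature.NumberTheory.DiophantineGeometry.MatIdx m) ℂ) (_ : Literature.NumberTheory.DiophantineGeometry.IsUpperTriangular g), LinearMap.ker ((MvPolynomial.aeval (R := ℂ) fun p : Literature.NumberTheory.DiophantineGeometry.MatIdx m × Literature.NumberTheory.DiophantineGeometry.MatIdx m => ∑ l : Literature.NumberTheory.DiophantineGeometry.MatIdx m, ((g⁻¹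 : Matrix.GeneralLinearGroup (Literature.NumberTheory.DiophantineGeometry.MatIdx m) ℂ) : Matrix (Literature.NumberTheory.DiophantineGeometry.MatIdx m) (Literature.NumberTheory.DiophantineGeometry.MatIdx m) ℂ) p.1 l • MvPolynomial.X (l, p.2)).toLinearMap - Literature.NumberTheory.DiophantineGeometry.weightChar χ g • LinearMap.id (R := ℂ) (M := MvPolynomial (Literature.NumberTheory.DiophantineGeometry.MatIdx m × Literature.NumberTheory.DiophantineGeometry.MatIdx m) ℂ))); Literature.NumberTheory.DiophantineGeometry.orbitMultiplicity ℂ (Literature.NumberTheory.DiophantineGeometry.paddedPerFormLex ℂ n m) m χ ≤ Module.finrank ℂ ↥T :=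
  noValuativeFlip_body_of_card_parts ValuativeBound_proof m U r hU δ lam hcard hm

/-- **`NoValuativeFlip` restricted to shapes with at most `ρ` rows holds with exponent `ρ + 2`,
unconditionally** (`c₀ = ρ + 2`, `n₀ = 2 ^ ρ + 1`; the body is the item's, with the extra hypothesis
`ℓ(λ) ≤ ρ`). So a valuative flip at padding `m ≥ n ^ c`, `n > 2 ^ (c-2)`, needs more than `c - 2`
rows. -/
theorem noValuativeFlip_boundedLength' (ρ : ℕ) :
    ∃ c₀ n₀ : ℕ, ∀ n ≥ n₀, ∀ (m : ℕ) [NeZero m], n ^ c₀ ≤ m → ∀ (U : Submodule ℂ (Literature.NumberTheory.DiophantineGeometry.MatIdx m → ℂ)) (r : ℕ), (∀ u ∈ U, (Matrix.of fun a b : Fin m => u (toLex (a, b))).rank ≤ r) → ∀ (δ : ℕ) (lam : Nat.Partition (m * δ)), lam.parts.card ≤ ρ → lam.parts.card ≤ m * m → let χ : Literature.NumberTheory.DiophantineGeometry.Weight (Literature.NumberTheory.DiophantineGeometry.MatIdx m) := (Literature.NumberTheory.DiophantineGeometry.Weight.dualOfPartition (m * m) lam).toMatIdx; let T : Submodule ℂ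 (MvPolynomial (Literature.NumberTheory.DiophantineGeometry.MatIdx m × Literature.NumberTheory.DiophantineGeometry.MatIdx m) ℂ) := MvPolynomial.homogeneousSubmodule (Literature.NumberTheory.DiophantineGeometry.MatIdx m × Literature.NumberTheory.DiophantineGeometry.MatIdx m) ℂ (m * δ) ⊓ ((MvPolynomial.vanishingIdeal ℂ {p : Literature.NumberTheory.DiophantineGeometry.MatIdx m × Literature.NumberTheory.DiophantineGeometry.MatIdx m → ℂ | ∀ j : Literature.NumberTheory.DiophantineGeometry.MatIdx m, (fun i => p (j, i)) ∈ U}) ^ (δ * (m - r))).restrictScalars ℂ ⊓ (⨅ (M : Matrix (Literature.NumberTheory.DiophantineGeometry.MatIdx m) (Literature.NumberTheory.DiophantineGeometry.MatIdx m) ℂ) (_ : Literature.Computability.AlgebraicComplexity.linSubst (Literature.NumberTheory.DiophantineGeometry.MatIdx m) ℂ M (Literature.NumberTheory.DiophantineGeometry.detFormLex ℂ m) = Literature.NumberTheory.DiophantineGeometry.detFormLex ℂ m), LinearMap.ker ((MvPolynomial.aeval (R := ℂ) fun p : Literature.NumberTheory.DiophantineGeometry.MatIdx m × Literature.NumberTheory.DiophantineGeometry.MatIdx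 m => ∑ l : Literature.NumberTheory.DiophantineGeometry.MatIdx m, M l p.2 • MvPolynomial.X (p.1, l)).toLinearMap - LinearMap.id (R := ℂ) (M := MvPolynomial (Literature.NumberTheory.DiophantineGeometry.MatIdx m × Literature.NumberTheory.DiophantineGeometry.MatIdx m) ℂ))) ⊓ (⨅ (g : Matrix.GeneralLinearGroup (Literature.NumberTheory.DiophantineGeometry.MatIdx m) ℂ) (_ : Literature.NumberTheory.DiophantineGeometry.IsUpperTriangular g), LinearMap.ker ((MvPolynomial.aeval (R := ℂ) fun p : Literature.NumberTheory.DiophantineGeometry.MatIdx m × Literature.NumberTheory.DiophantineGeometry.MatIdx m => ∑ l : Literature.NumberTheory.DiophantineGeometry.MatIdx m, ((g⁻¹ : Matrix.GeneralLinearGroup (Literature.NumberTheory.DiophantineGeometry.MatIdx m) ℂ) : Matrix (Literature.NumberTheory.DiophantineGeometry.MatIdx m) (Literature.NumberTheory.DiophantineGeometry.MatIdx m) ℂ) p.1 l • MvPolynomial.X (l, p.2)).toLinearMap - Literature.NumberTheory.DiophantineGeometry.weightChar χ g • LinearMap.id (R := ℂ) (M := MvPolynomial (Literature.NumberTheory.DiophantineGeometry.MatIdx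 m × Literature.NumberTheory.DiophantineGeometry.MatIdx m) ℂ))); Literature.NumberTheory.DiophantineGeometry.orbitMultiplicity ℂ (Literature.NumberTheory.DiophantineGeometry.paddedPerFormLex ℂ n m) m χ ≤ Module.finrank ℂ ↥T :=
  noValuativeFlip_boundedLength ValuativeBound_proof ρ

/-- **The residual form of `NoValuativeFlip`, unconditionally.** The item holds iff it holds on the
residual range: paddings `n ^ c₀ ≤ m` with `m + 1 < 2ⁿ`, Kadish–Landsberg shapes
(`δ (m - n) ≤ λ₁`, `ℓ(λ) ≤ n² + 1`) of length beyond the inheritance range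
(`m < 1 + n (n + 1)^ℓ(λ)`) — the multiplicity no-go question on shapes whose length grows with `n`
(Bläser–Ikenmeyer 2025 §12.4). -/
theorem noValuativeFlip_iff_residual' :
    NoValuativeFlip ↔
    ∃ c₀ n₀ : ℕ, ∀ n ≥ n₀, ∀ (m : ℕ) [NeZero m], n ^ c₀ ≤ m → m + 1 < 2 ^ n → ∀ (U : Submodule ℂ (Literature.NumberTheory.DiophantineGeometry.MatIdx m → ℂ)) (r : ℕ), (∀ u ∈ U, (Matrix.of fun a b : Fin m => u (toLex (a, b))).rank ≤ r) → ∀ (δ : ℕ) (lam : Nat.Partition (m * δ)), lam.parts.card ≤ m * m → δ * (m - n) ≤ lam.parts.sup → lam.parts.card ≤ n ^ 2 + 1 → m < 1 + n * (n + 1) ^ lam.parts.card → let χ : Literature.NumberTheory.DiophantineGeometry.Weight (Literature.NumberTheory.DiophantineGeometry.MatIdx m) := (Literature.NumberTheory.DiophantineGeometry.Weight.dualOfPartition (m * m) lam).toMatIdx; let T : Submodule ℂ (MvPolynomial (Literature.NumberTheory.DiophantineGeometry.MatIdx m × Literature.NumberTheory.DiophantineGeometry.MatIdx m) ℂ) :=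 MvPolynomial.homogeneousSubmodule (Literature.NumberTheory.DiophantineGeometry.MatIdx m × Literature.NumberTheory.DiophantineGeometry.MatIdx m) ℂ (m * δ) ⊓ ((MvPolynomial.vanishingIdeal ℂ {p : Literature.NumberTheory.DiophantineGeometry.MatIdx m × Literature.NumberTheory.DiophantineGeometry.MatIdx m → ℂ | ∀ j : Literature.NumberTheory.DiophantineGeometry.MatIdx m, (fun i => p (j, i)) ∈ U}) ^ (δ * (m - r))).restrictScalars ℂ ⊓ (⨅ (M : Matrix (Literature.NumberTheory.DiophantineGeometry.MatIdx m) (Literature.NumberTheory.DiophantineGeometry.MatIdx m) ℂ) (_ : Literature.Computability.AlgebraicComplexity.linSubst (Literature.NumberTheory.DiophantineGeometry.MatIdx m) ℂ M (Literature.NumberTheory.DiophantineGeometry.detFormLex ℂ m) = Literature.NumberTheory.DiophantineGeometry.detFormLex ℂ m), LinearMap.ker ((MvPolynomial.aeval (R := ℂ) fun p : Literature.NumberTheory.DiophantineGeometry.MatIdx m × Literature.NumberTheory.DiophantineGeometry.MatIdx m => ∑ l : Literature.NumberTheory.DiophantineGeometry.MatIdx m, M l p.2 • MvPolynomial.X (p.1,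 l)).toLinearMap - LinearMap.id (R := ℂ) (M := MvPolynomial (Literature.NumberTheory.DiophantineGeometry.MatIdx m × Literature.NumberTheory.DiophantineGeometry.MatIdx m) ℂ))) ⊓ (⨅ (g : Matrix.GeneralLinearGroup (Literature.NumberTheory.DiophantineGeometry.MatIdx m) ℂ) (_ : Literature.NumberTheory.DiophantineGeometry.IsUpperTriangular g), LinearMap.ker ((MvPolynomial.aeval (R := ℂ) fun p : Literature.NumberTheory.DiophantineGeometry.MatIdx m × Literature.NumberTheory.DiophantineGeometry.MatIdx m => ∑ l : Literature.NumberTheory.DiophantineGeometry.MatIdx m, ((g⁻¹ : Matrix.GeneralLinearGroup (Literature.NumberTheory.DiophantineGeometry.MatIdx m) ℂ) : Matrix (Literature.NumberTheory.DiophantineGeometry.MatIdx m) (Literature.NumberTheory.DiophantineGeometry.MatIdx m) ℂ) p.1 l • MvPolynomial.X (l, p.2)).toLinearMap - Literature.NumberTheory.DiophantineGeometry.weightChar χ g • LinearMap.id (R := ℂ) (M := MvPolynomial (Literature.NumberTheory.DiophantineGeometry.MatIdx m × Literature.NumberTheory.DiophantineGeometry.MatIdx m) ℂ))); Literature.NumberTheory.DiophantineGeometry.orbitMultiplicity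 ℂ (Literature.NumberTheory.DiophantineGeometry.paddedPerFormLex ℂ n m) m χ ≤ Module.finrank ℂ ↥T :=
  noValuativeFlip_iff_residual ValuativeBound_proof

/-! ## §3 The padding exponent is load-bearing -/

/-- **Any exponent witnessing `NoValuativeFlip` is at least `2`.** If the body of the item holds
from the padding `n ^ c₀` on (threshold `n₀`), then `c₀ ≥ 2`: for `c₀ ≤ 1` the padding `m = n`
(`n = max n₀ 3`) is admissible, and there the bottom-of-the-window flip
`ValuativeFlip.valuativeFlip_cruxBody_bottom` (for `n ≥ 3` some `λ ⊢ n δ` has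
`dim T_⊥(λ) < mult_λ* ℂ[Δ_n(per_n)]`, a Hilbert-function count: the permanent's orbit closure is
bigger than the explicit det-side census at `m = n`) contradicts the body at the no-cut centre
`U = ⊥`, `r = 0`. -/
theorem two_le_of_noValuativeFlip_exponent {c₀ n₀ : ℕ}
    (h : ∀ n ≥ n₀, ∀ (m : ℕ) [NeZero m], n ^ c₀ ≤ m → ∀ (U : Submodule ℂ (Literature.NumberTheory.DiophantineGeometry.MatIdx m → ℂ)) (r : ℕ), (∀ u ∈ U, (Matrix.of fun a b : Fin m => u (toLex (a, b))).rank ≤ r) → ∀ (δ : ℕ) (lam : Nat.Partition (m * δ)), lam.parts.card ≤ m * m → let χ : Literature.NumberTheory.DiophantineGeometry.Weight (Literature.NumberTheory.DiophantineGeometry.MatIdx m) := (Literature.NumberTheory.DiophantineGeometry.Weight.dualOfPartition (m * m) lam).toMatIdx; let T : Submodule ℂ (MvPolynomial (Literature.NumberTheory.DiophantineGeometry.MatIdx m × Literature.NumberTheory.DiophantineGeometry.MatIdx m) ℂ) := MvPolynomial.homogeneousSubmodule (Literature.NumberTheory.DiophantineGeometry.MatIdx m × Literature.NumberTheory.DiophantineGeometry.MatIdx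 m) ℂ (m * δ) ⊓ ((MvPolynomial.vanishingIdeal ℂ {p : Literature.NumberTheory.DiophantineGeometry.MatIdx m × Literature.NumberTheory.DiophantineGeometry.MatIdx m → ℂ | ∀ j : Literature.NumberTheory.DiophantineGeometry.MatIdx m, (fun i => p (j, i)) ∈ U}) ^ (δ * (m - r))).restrictScalars ℂ ⊓ (⨅ (M : Matrix (Literature.NumberTheory.DiophantineGeometry.MatIdx m) (Literature.NumberTheory.DiophantineGeometry.MatIdx m) ℂ) (_ : Literature.Computability.AlgebraicComplexity.linSubst (Literature.NumberTheory.DiophantineGeometry.MatIdx m) ℂ M (Literature.NumberTheory.DiophantineGeometry.detFormLex ℂ m) = Literature.NumberTheory.DiophantineGeometry.detFormLex ℂ m), LinearMap.ker ((MvPolynomial.aeval (R := ℂ) fun p : Literature.NumberTheory.DiophantineGeometry.MatIdx m × Literature.NumberTheory.DiophantineGeometry.MatIdx m => ∑ l : Literature.NumberTheory.DiophantineGeometry.MatIdx m, M l p.2 • MvPolynomial.X (p.1, l)).toLinearMap - LinearMap.id (R := ℂ) (M := MvPolynomial (Literature.NumberTheory.DiophantineGeometry.MatIdx m × Literature.NumberTheory.DiophantineGeometry.MatIdx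 m) ℂ))) ⊓ (⨅ (g : Matrix.GeneralLinearGroup (Literature.NumberTheory.DiophantineGeometry.MatIdx m) ℂ) (_ : Literature.NumberTheory.DiophantineGeometry.IsUpperTriangular g), LinearMap.ker ((MvPolynomial.aeval (R := ℂ) fun p : Literature.NumberTheory.DiophantineGeometry.MatIdx m × Literature.NumberTheory.DiophantineGeometry.MatIdx m => ∑ l : Literature.NumberTheory.DiophantineGeometry.MatIdx m, ((g⁻¹ : Matrix.GeneralLinearGroup (Literature.NumberTheory.DiophantineGeometry.MatIdx m) ℂ) : Matrix (Literature.NumberTheory.DiophantineGeometry.MatIdx m) (Literature.NumberTheory.DiophantineGeometry.MatIdx m) ℂ) p.1 l • MvPolynomial.X (l, p.2)).toLinearMap - Literature.NumberTheory.DiophantineGeometry.weightChar χ g • LinearMap.id (R := ℂ) (M := MvPolynomial (Literature.NumberTheory.DiophantineGeometry.MatIdx m × Literature.NumberTheory.DiophantineGeometry.MatIdx m) ℂ))); Literature.NumberTheory.DiophantineGeometry.orbitMultiplicity ℂ (Literature.NumberTheory.DiophantineGeometry.paddedPerFormLex ℂ n m) m χ ≤ Module.finrank ℂ ↥T) :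
    2 ≤ c₀ := by
  by_contra hc
  rw [not_le] at hc
  set n : ℕ := max n₀ 3 with hn
  have hn0 : n₀ ≤ n := le_max_left _ _
  have hn3 : 3 ≤ n := le_max_right _ _
  haveI : NeZero n := ⟨by omega⟩
  have hpad : n ^ c₀ ≤ n := by
    interval_cases c₀
    · rw [pow_zero]; omega
    · rw [pow_one]
  obtain ⟨U, r, δ, lam, hU, hcard, hlt⟩ := valuativeFlip_cruxBody_bottom n hn3
  exact (not_le.mpr hlt) (h n hn0 n hpad U r hU δ lam hcard)

/-- **The linear-padding version of `NoValuativeFlip` is false**: there is no threshold `n₀` beyond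
which the valuative inequality holds for ALL `m ≥ n` — it fails at `m = n` for every `n ≥ 3`
(`valuativeFlip_cruxBody_bottom`). The item's polynomial padding `n ^ c₀`, `c₀ ≥ 2`, is therefore
essential; whether exponent `2` (paddings `m ≥ n²`) already suffices is open. -/
theorem not_noValuativeFlip_linearPadding :
    ¬ ∃ n₀ : ℕ, ∀ n ≥ n₀, ∀ (m : ℕ) [NeZero m], n ≤ m → ∀ (U : Submodule ℂ (Literature.NumberTheory.DiophantineGeometry.MatIdx m → ℂ)) (r : ℕ), (∀ u ∈ U, (Matrix.of fun a b : Fin m => u (toLex (a, b))).rank ≤ r) → ∀ (δ : ℕ) (lam : Nat.Partition (m * δ)), lam.parts.card ≤ m * m → let χ : Literature.NumberTheory.DiophantineGeometry.Weight (Literature.NumberTheory.DiophantineGeometry.MatIdx m) := (Literature.NumberTheory.DiophantineGeometry.Weight.dualOfPartition (m * m) lam).toMatIdx; let T : Submodule ℂ (MvPolynomial (Literature.NumberTheory.DiophantineGeometry.MatIdx m × Literature.NumberTheory.DiophantineGeometry.MatIdx m) ℂ) := MvPolynomial.homogeneousSubmodule (Literature.NumberTheory.DiophantineGeometry.MatIdx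 m × Literature.NumberTheory.DiophantineGeometry.MatIdx m) ℂ (m * δ) ⊓ ((MvPolynomial.vanishingIdeal ℂ {p : Literature.NumberTheory.DiophantineGeometry.MatIdx m × Literature.NumberTheory.DiophantineGeometry.MatIdx m → ℂ | ∀ j : Literature.NumberTheory.DiophantineGeometry.MatIdx m, (fun i => p (j, i)) ∈ U}) ^ (δ * (m - r))).restrictScalars ℂ ⊓ (⨅ (M : Matrix (Literature.NumberTheory.DiophantineGeometry.MatIdx m) (Literature.NumberTheory.DiophantineGeometry.MatIdx m) ℂ) (_ : Literature.Computability.AlgebraicComplexity.linSubst (Literature.NumberTheory.DiophantineGeometry.MatIdx m) ℂ M (Literature.NumberTheory.DiophantineGeometry.detFormLex ℂ m) = Literature.NumberTheory.DiophantineGeometry.detFormLex ℂ m), LinearMap.ker ((MvPolynomial.aeval (R := ℂ) fun p : Literature.NumberTheory.DiophantineGeometry.MatIdx m × Literature.NumberTheory.DiophantineGeometry.MatIdx m => ∑ l : Literature.NumberTheory.DiophantineGeometry.MatIdx m, M l p.2 • MvPolynomial.X (p.1, l)).toLinearMap - LinearMap.id (R := ℂ) (M := MvPolynomial (Literature.NumberTheory.DiophantineGeometry.MatIdx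 m × Literature.NumberTheory.DiophantineGeometry.MatIdx m) ℂ))) ⊓ (⨅ (g : Matrix.GeneralLinearGroup (Literature.NumberTheory.DiophantineGeometry.MatIdx m) ℂ) (_ : Literature.NumberTheory.DiophantineGeometry.IsUpperTriangular g), LinearMap.ker ((MvPolynomial.aeval (R := ℂ) fun p : Literature.NumberTheory.DiophantineGeometry.MatIdx m × Literature.NumberTheory.DiophantineGeometry.MatIdx m => ∑ l : Literature.NumberTheory.DiophantineGeometry.MatIdx m, ((g⁻¹ : Matrix.GeneralLinearGroup (Literature.NumberTheory.DiophantineGeometry.MatIdx m) ℂ) : Matrix (Literature.NumberTheory.DiophantineGeometry.MatIdx m) (Literature.NumberTheory.DiophantineGeometry.MatIdx m) ℂ) p.1 l • MvPolynomial.X (l, p.2)).toLinearMap - Literature.NumberTheory.DiophantineGeometry.weightChar χ g • LinearMap.id (R := ℂ) (M := MvPolynomial (Literature.NumberTheory.DiophantineGeometry.MatIdx m × Literature.NumberTheory.DiophantineGeometry.MatIdx m) ℂ))); Literature.NumberTheory.DiophantineGeometry.orbitMultiplicity ℂ (Literature.NumberTheory.DiophantineGeometry.paddedPerFormLex ℂ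 n m) m χ ≤ Module.finrank ℂ ↥T := by
  rintro ⟨n₀, h⟩
  have h1 : ∀ n ≥ n₀, ∀ (m : ℕ) [NeZero m], n ^ 1 ≤ m → ∀ (U : Submodule ℂ (Literature.NumberTheory.DiophantineGeometry.MatIdx m → ℂ)) (r : ℕ), (∀ u ∈ U, (Matrix.of fun a b : Fin m => u (toLex (a, b))).rank ≤ r) → ∀ (δ : ℕ) (lam : Nat.Partition (m * δ)), lam.parts.card ≤ m * m → let χ : Literature.NumberTheory.DiophantineGeometry.Weight (Literature.NumberTheory.DiophantineGeometry.MatIdx m) := (Literature.NumberTheory.DiophantineGeometry.Weight.dualOfPartition (m * m) lam).toMatIdx; let T : Submodule ℂ (MvPolynomial (Literature.NumberTheory.DiophantineGeometry.MatIdx m × Literature.NumberTheory.DiophantineGeometry.MatIdx m) ℂ) := MvPolynomial.homogeneousSubmodule (Literature.NumberTheory.DiophantineGeometry.MatIdx m × Literature.NumberTheory.DiophantineGeometry.MatIdx m) ℂ (m * δ) ⊓ ((MvPolynomial.vanishingIdeal ℂ {p : Literature.NumberTheory.DiophantineGeometry.MatIdx m × Literature.NumberTheory.DiophantineGeometry.MatIdx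 m → ℂ | ∀ j : Literature.NumberTheory.DiophantineGeometry.MatIdx m, (fun i => p (j, i)) ∈ U}) ^ (δ * (m - r))).restrictScalars ℂ ⊓ (⨅ (M : Matrix (Literature.NumberTheory.DiophantineGeometry.MatIdx m) (Literature.NumberTheory.DiophantineGeometry.MatIdx m) ℂ) (_ : Literature.Computability.AlgebraicComplexity.linSubst (Literature.NumberTheory.DiophantineGeometry.MatIdx m) ℂ M (Literature.NumberTheory.DiophantineGeometry.detFormLex ℂ m) = Literature.NumberTheory.DiophantineGeometry.detFormLex ℂ m), LinearMap.ker ((MvPolynomial.aeval (R := ℂ) fun p : Literature.NumberTheory.DiophantineGeometry.MatIdx m × Literature.NumberTheory.DiophantineGeometry.MatIdx m => ∑ l : Literature.NumberTheory.DiophantineGeometry.MatIdx m, M l p.2 • MvPolynomial.X (p.1, l)).toLinearMap - LinearMap.id (R := ℂ) (M := MvPolynomial (Literature.NumberTheory.DiophantineGeometry.MatIdx m × Literature.NumberTheory.DiophantineGeometry.MatIdx m) ℂ))) ⊓ (⨅ (g : Matrix.GeneralLinearGroup (Literature.NumberTheory.DiophantineGeometry.MatIdx m) ℂ) (_ : Literature.NumberTheory.DiophantineGeometry.IsUpperTriangular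 g), LinearMap.ker ((MvPolynomial.aeval (R := ℂ) fun p : Literature.NumberTheory.DiophantineGeometry.MatIdx m × Literature.NumberTheory.DiophantineGeometry.MatIdx m => ∑ l : Literature.NumberTheory.DiophantineGeometry.MatIdx m, ((g⁻¹ : Matrix.GeneralLinearGroup (Literature.NumberTheory.DiophantineGeometry.MatIdx m) ℂ) : Matrix (Literature.NumberTheory.DiophantineGeometry.MatIdx m) (Literature.NumberTheory.DiophantineGeometry.MatIdx m) ℂ) p.1 l • MvPolynomial.X (l, p.2)).toLinearMap - Literature.NumberTheory.DiophantineGeometry.weightChar χ g • LinearMap.id (R := ℂ) (M := MvPolynomial (Literature.NumberTheory.DiophantineGeometry.MatIdx m × Literature.NumberTheory.DiophantineGeometry.MatIdx m) ℂ))); Literature.NumberTheory.DiophantineGeometry.orbitMultiplicity ℂ (Literature.NumberTheory.DiophantineGeometry.paddedPerFormLex ℂ n m) m χ ≤ Module.finrank ℂ ↥T := by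
    intro n hn m _ hm
    exact h n hn m (by simpa using hm)
  exact absurd (two_le_of_noValuativeFlip_exponent h1) (by norm_num)

/-- **Normal form of the item**: `NoValuativeFlip` is equivalent to its restriction to exponents
`c₀ ≥ 2` (by `two_le_of_noValuativeFlip_exponent`). -/
theorem noValuativeFlip_iff_two_le :
    NoValuativeFlip ↔ ∃ c₀ n₀ : ℕ, 2 ≤ c₀ ∧ ∀ n ≥ n₀, ∀ (m : ℕ) [NeZero m], n ^ c₀ ≤ m → ∀ (U : Submodule ℂ (Literature.NumberTheory.DiophantineGeometry.MatIdx m → ℂ)) (r : ℕ), (∀ u ∈ U, (Matrix.of fun a b : Fin m => u (toLex (a, b))).rank ≤ r) → ∀ (δ : ℕ) (lam : Nat.Partition (m * δ)), lam.parts.card ≤ m * m → let χ : Literature.NumberTheory.DiophantineGeometry.Weight (Literature.NumberTheory.DiophantineGeometry.MatIdx m) := (Literature.NumberTheory.DiophantineGeometry.Weight.dualOfPartition (m * m) lam).toMatIdx; let T : Submodule ℂ (MvPolynomial (Literature.NumberTheory.DiophantineGeometry.MatIdx m × Literature.NumberTheory.DiophantineGeometry.MatIdx m) ℂ) := MvPolynomial.homogeneousSubmodule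 (Literature.NumberTheory.DiophantineGeometry.MatIdx m × Literature.NumberTheory.DiophantineGeometry.MatIdx m) ℂ (m * δ) ⊓ ((MvPolynomial.vanishingIdeal ℂ {p : Literature.NumberTheory.DiophantineGeometry.MatIdx m × Literature.NumberTheory.DiophantineGeometry.MatIdx m → ℂ | ∀ j : Literature.NumberTheory.DiophantineGeometry.MatIdx m, (fun i => p (j, i)) ∈ U}) ^ (δ * (m - r))).restrictScalars ℂ ⊓ (⨅ (M : Matrix (Literature.NumberTheory.DiophantineGeometry.MatIdx m) (Literature.NumberTheory.DiophantineGeometry.MatIdx m) ℂ) (_ : Literature.Computability.AlgebraicComplexity.linSubst (Literature.NumberTheory.DiophantineGeometry.MatIdx m) ℂ M (Literature.NumberTheory.DiophantineGeometry.detFormLex ℂ m) = Literature.NumberTheory.DiophantineGeometry.detFormLex ℂ m), LinearMap.ker ((MvPolynomial.aeval (R := ℂ) fun p : Literature.NumberTheory.DiophantineGeometry.MatIdx m × Literature.NumberTheory.DiophantineGeometry.MatIdx m => ∑ l : Literature.NumberTheory.DiophantineGeometry.MatIdx m, M l p.2 • MvPolynomial.X (p.1, l)).toLinearMap - LinearMap.id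 (R := ℂ) (M := MvPolynomial (Literature.NumberTheory.DiophantineGeometry.MatIdx m × Literature.NumberTheory.DiophantineGeometry.MatIdx m) ℂ))) ⊓ (⨅ (g : Matrix.GeneralLinearGroup (Literature.NumberTheory.DiophantineGeometry.MatIdx m) ℂ) (_ : Literature.NumberTheory.DiophantineGeometry.IsUpperTriangular g), LinearMap.ker ((MvPolynomial.aeval (R := ℂ) fun p : Literature.NumberTheory.DiophantineGeometry.MatIdx m × Literature.NumberTheory.DiophantineGeometry.MatIdx m => ∑ l : Literature.NumberTheory.DiophantineGeometry.MatIdx m, ((g⁻¹ : Matrix.GeneralLinearGroup (Literature.NumberTheory.DiophantineGeometry.MatIdx m) ℂ) : Matrix (Literature.NumberTheory.DiophantineGeometry.MatIdx m) (Literature.NumberTheory.DiophantineGeometry.MatIdx m) ℂ) p.1 l • MvPolynomial.X (l, p.2)).toLinearMap - Literature.NumberTheory.DiophantineGeometry.weightChar χ g • LinearMap.id (R := ℂ) (M := MvPolynomial (Literature.NumberTheory.DiophantineGeometry.MatIdx m × Literature.NumberTheory.DiophantineGeometry.MatIdx m) ℂ))); Literature.NumberTheory.DiophantineGeometry.orbitMultiplicity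 ℂ (Literature.NumberTheory.DiophantineGeometry.paddedPerFormLex ℂ n m) m χ ≤ Module.finrank ℂ ↥T := by
  constructor
  · rintro ⟨c₀, n₀, h⟩
    exact ⟨c₀, n₀, two_le_of_noValuativeFlip_exponent h, h⟩
  · rintro ⟨c₀, n₀, -, h⟩
    exact ⟨c₀, n₀, h⟩

/-! ## §4 The same pin for the multiplicity no-go `GCTMult.GctNoMultBarrier` -/

/-- **A multiplicity obstruction at the bottom of every window.** For every `n ≥ 3` there are `δ`
and `λ ⊢ n δ` with at most `n²` parts such that `K_n(λ*) < mult_λ* ℂ[Δ_n(per_n)]`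
(`per_n = paddedPerFormLex ℂ n n`): the valuative bound `K_n(λ*) ≤ dim T_⊥(λ)`
(`ValuativeBound_proof` at the no-cut centre) composed with the bottom-of-the-window flip
`dim T_⊥(λ) < mult_λ*(per_n)` (`valuativeFlip_cruxBody_bottom`). Non-membership `per_n ∉ Δ(det_n)`
is classical (dimension count); that it is witnessed by a MULTIPLICITY obstruction is the content
(multiplicity obstructions are not complete for non-membership). -/
theorem exists_orbitMultiplicity_det_lt_per (n : ℕ) [NeZero n] (hn : 3 ≤ n) :
    ∃ (δ : ℕ) (lam : Nat.Partition (n * δ)), lam.parts.card ≤ n * n ∧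
      orbitMultiplicity ℂ (detFormLex ℂ n) n
          ((Weight.dualOfPartition (n * n) lam).toMatIdx : Weight (MatIdx n)) <
        orbitMultiplicity ℂ (paddedPerFormLex ℂ n n) n
          ((Weight.dualOfPartition (n * n) lam).toMatIdx : Weight (MatIdx n)) := by
  obtain ⟨U, r, δ, lam, hU, hcard, hlt⟩ := valuativeFlip_cruxBody_bottom n hn
  exact ⟨δ, lam, hcard, lt_of_le_of_lt (ValuativeBound_proof n U r hU δ lam hcard) hlt⟩

/-- **Any exponent witnessing `GCTMult.GctNoMultBarrier` is at least `2`** (stmt-ValiantsHypothesis-0890,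
the multiplicity no-go: `mult_pp(χ) ≤ K_m(χ)` for all weights from the padding `n ^ c₀` on): for
`c₀ ≤ 1` the padding `m = n` is admissible and `exists_orbitMultiplicity_det_lt_per` is a
multiplicity obstruction there. So both no-go statements of the two GCT routes live at exponents
`c₀ ≥ 2` (and BIP2019's no-occurrence theorem at `c₀ = 25`). -/
theorem two_le_of_gctNoMultBarrier_exponent {c₀ n₀ : ℕ}
    (h : ∀ n ≥ n₀, ∀ (m : ℕ) [NeZero m], n ^ c₀ ≤ m →
      ∀ χ : Weight (MatIdx m), orbitMultiplicity ℂ (paddedPerFormLex ℂ n m) m χ ≤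
        orbitMultiplicity ℂ (detFormLex ℂ m) m χ) :
    2 ≤ c₀ := by
  by_contra hc
  rw [not_le] at hc
  set n : ℕ := max n₀ 3 with hn
  have hn0 : n₀ ≤ n := le_max_left _ _
  have hn3 : 3 ≤ n := le_max_right _ _
  haveI : NeZero n := ⟨by omega⟩
  have hpad : n ^ c₀ ≤ n := by
    interval_cases c₀
    · rw [pow_zero]; omega
    · rw [pow_one]
  obtain ⟨δ, lam, -, hlt⟩ := exists_orbitMultiplicity_det_lt_per n hn3
  exact (not_le.mpr hlt) (h n hn0 n hpad _)

/-- **Normal form of the multiplicity no-go**: `GCTMult.GctNoMultBarrier` is equivalent to its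
restriction to exponents `c₀ ≥ 2` (by `two_le_of_gctNoMultBarrier_exponent`). -/
theorem gctNoMultBarrier_iff_two_le :
    Summit.ValiantsHypothesis.ValiantsHypothesis.Theses.GCTMult.GctNoMultBarrier ↔
    ∃ c₀ n₀ : ℕ, 2 ≤ c₀ ∧ ∀ n ≥ n₀, ∀ (m : ℕ) [NeZero m], n ^ c₀ ≤ m →
      ∀ χ : Weight (MatIdx m), orbitMultiplicity ℂ (paddedPerFormLex ℂ n m) m χ ≤
        orbitMultiplicity ℂ (detFormLex ℂ m) m χ := by
  constructor
  · rintro ⟨c₀, n₀, h⟩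
    exact ⟨c₀, n₀, two_le_of_gctNoMultBarrier_exponent h, h⟩
  · rintro ⟨c₀, n₀, -, h⟩
    exact ⟨c₀, n₀, h⟩

/-! ## §5 The bottom obstruction in border-complexity currency -/

/-- **The permanent is not a degeneration of the determinant of the same size** (`n ≥ 3`):
`X₀₀^0 · per_n ∉ \overline{GL_{n²} · det_n}`, i.e. `¬ HasBorderDetRepr ℂ n n`. Proof BY
MULTIPLICITY OBSTRUCTION: `exists_orbitMultiplicity_det_lt_per` supplies a weight `λ*` with
`K_n(λ*) < mult_λ* ℂ[Δ_n(per_n)]`, and the multiplicity-obstruction principle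
(`GctMultPrinciple_proof`, stmt-ValiantsHypothesis-0889: BLMW 2011 Prop. 3.3.2) excludes the
permanent from the orbit closure. Classically this is the dimension count
`dim GL·per_n = n⁴ - 2n + 2 > n⁴ - 2n² + 2 = dim GL·det_n` (Marcus–May 1962 stabiliser;
Mulmuley–Sohoni 2001 §4); `per_2 ∈ GL_4 · det_2` shows `n ≥ 3` is needed. -/
theorem not_hasBorderDetRepr_self (n : ℕ) [NeZero n] (hn : 3 ≤ n) : ¬ HasBorderDetRepr ℂ n n := by
  obtain ⟨δ, lam, -, hlt⟩ := exists_orbitMultiplicity_det_lt_per n hn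
  exact Summit.ValiantsHypothesis.ValiantsHypothesis.Theorems.GctMultPrinciple_proof n n _ le_rfl hlt

/-- **`n < bdc(per_n)` for `n ≥ 3`**: the border determinantal complexity of the `n × n`
permanent exceeds `n` (the tree's `le_borderDetComplexityPer_holds` gives `n ≤ bdc(per_n)`; the
infimum is attained, `hasBorderDetRepr_borderDetComplexityPer`, and `not_hasBorderDetRepr_self`
excludes equality). In print: `bdc(per_n) ≥ n²/2` (Landsberg–Manivel–Ressayre 2013 Thm 1.1.1,
a named fact in the tree). -/
theorem lt_borderDetComplexityPer_self (n : ℕ) (hn : 3 ≤ n) :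
    n < borderDetComplexityPer ℂ n := by
  obtain ⟨hpos, hle, hrepr⟩ := hasBorderDetRepr_borderDetComplexityPer (k := ℂ) n
  refine lt_of_le_of_ne hle fun heq => ?_
  generalize borderDetComplexityPer ℂ n = M at hpos hle hrepr heq
  subst heq
  haveI : NeZero n := NeZero.of_pos hpos
  exact not_hasBorderDetRepr_self n hn hrepr

end Summit.ValiantsHypothesis.ValiantsHypothesis.Theorems.NoValuativeFlip
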